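import Mathlib
import Summits.FinalStateConjecture.FinalStateConjecture.Theses.TwoBoundarySqueeze
import Literature.Geometry.Lorentzian.TameGenericityLocal

/-!
# Birth skeleton of piece X₃ `CensoredLanding` (Sub₃ of line `censored-curves-split`, crux
# `GenericCensorshipThirdLaw`, stmt-FinalStateConjecture-17297; = stub `stub_censoredLanding`, shared
# verbatim with the sibling crux `GenericCensoredCapture`) — BC3 "a plan for the piece" (v2 texts)

`CensoredLanding_of : stub_enrichOffExtremal → stub_censoredAlongEnrichment → stub_packGeneralPosition →
CensoredLanding` (conclusion = verbatim the piece's registered text).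

Input of the piece: a tame, immersed, injective admissible curve `F` whose base datum has an MGHD with
incomplete `𝓘⁺` and whose members off `0` are censored (the witness tame weak cosmic censorship provides).
Plan = ENRICH, GENERAL POSITION, PACKAGE:

* `stub_enrichOffExtremal` — ENRICHMENT TRANSVERSE TO THE EXTREMAL STRATUM: `F` extends to a tame admissible
  TWO-parameter family `G` on the same end (`G ∘ L = F` along an injective linear `L : ℝ¹ → ℝ²`), immersed at
  `0`, such that for an OPEN DENSE set `U₁` of directions `u ∈ ℝ²` the ray `t ↦ G (t • u)` satisfies the C⁰
  third law for `0 < |t| < δ(u)` (the asymptotically-extremal data near the naked datum form a wall which a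
  compactly supported second direction crosses transversally; model: Angelopoulos–Kehle–Unger arXiv:2603.10378
  Thm 2, Kehle–Unger arXiv:2402.10190). [size: open-problem]
* `stub_censoredAlongEnrichment` — CENSORSHIP PERSISTS IN GENERAL-POSITION DIRECTIONS: for every such tame
  admissible immersed enrichment `G` of a censored curve whose base has an MGHD with incomplete `𝓘⁺`, an open
  dense set `U₂` of directions whose rays are censored for small `t ≠ 0` (the naked stratum through `G 0` is a
  wall: the robust form of the instability of naked singularities, Christodoulou Ann. Math. 149 Thm 4.1,
  restricted to enrichments of ONE censored curve — cf. `RobustClausewiseGenericity.CensorshipRobust`).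
  [size: open-problem]
* `stub_packGeneralPosition` — PACKAGING (provable now, M): pick `u ∈ U₁ ∩ U₂`, `u ≠ 0` (finite intersection
  of open dense sets is dense); `F' c := G (ψ (c 0) • u)` with `ψ` a bounded odd diffeomorphism onto a small
  interval (`exists_contDiff_radialContraction` shape): tame by `IsTameDataFamily.comp_contDiff`, immersed by
  the chain rule from `IsImmersedAtZero 2 G` at `v = u`, injective on the small interval by strict
  monotonicity of the immersed scalar component, admissible, and GOOD off `0`.

Composition: enrichment ⟶ censored directions of THAT enrichment ⟶ package; sorries only in the three stubs.
BC3 probes (`stub → piece`, `stub → FinalStateConjecture`, `exact?`/`aesop`): all fail (strategist folder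
`bc/v2_X3_birth_probe.lean`).
-/

set_option linter.dupNamespace false

noncomputable section

open scoped Manifold ContDiff Topology
open Set Function Filter

namespace Summit.FinalStateConjecture.FinalStateConjecture.Cruxes.GenericCensorshipThirdLaw.CensoredCurvesSplit.BirthX3

/-- **Stub A `stub_enrichOffExtremal`** — a tame admissible immersed 2-parameter enrichment of the censored
curve whose general-position rays leave the extremal stratum. [cite: AngelopoulosKehleUnger2026, Thm. 2] -/
theorem stub_enrichOffExtremal :
    ∀ (X : Type) [TopologicalSpace X] [ChartedSpace Literature.Geometry.Lorentzian.E3 X] [IsManifold (𝓡 3) (⊤ : ℕ∞) X] [T2Space X] [SecondCountableTopology X] [ConnectedSpace X], ∀ (e : Literature.Geometry.Lorentzian.AFEnd X) (F : (EuclideanSpace ℝ (Fin 1) → Literature.Geometry.Lorentzian.InitialDataSet (𝓡 3) X)), Literature.Geometry.Lorentzian.InitialDataSet.IsTameDataFamily e 1 F → Literature.Geometry.Lorentzian.InitialDataSet.IsImmersedAtZero 1 F → Function.Injective F → (∀ c, F c ∈ Literature.Geometry.Lorentzian.admissibleVacuumData X) → (∃ 𝒟 : Literature.Geometry.Lorentzian.VacuumCauchyDevelopment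 (F 0), 𝒟.IsMaximal ∧ ¬ Summit.FinalStateConjecture.HasCompleteNullInfinity 𝒟.toCauchyDevelopment) → (∀ c ≠ 0, (∀ 𝒟 : Literature.Geometry.Lorentzian.VacuumCauchyDevelopment (F c), 𝒟.IsMaximal → Summit.FinalStateConjecture.HasCompleteNullInfinity 𝒟.toCauchyDevelopment)) → ∃ (G : (EuclideanSpace ℝ (Fin 2) → Literature.Geometry.Lorentzian.InitialDataSet (𝓡 3) X)) (L : (EuclideanSpace ℝ (Fin 1) →ₗ[ℝ] EuclideanSpace ℝ (Fin 2))), Function.Injective L ∧ (∀ c, G (L c) = F c) ∧ Literature.Geometry.Lorentzian.InitialDataSet.IsTameDataFamily e 2 G ∧ Literature.Geometry.Lorentzian.InitialDataSet.IsImmersedAtZero 2 G ∧ (∀ q, G q ∈ Literature.Geometry.Lorentzian.admissibleVacuumData X) ∧ ∃ U₁ : Set (EuclideanSpace ℝ (Fin 2)), IsOpen U₁ ∧ Dense U₁ ∧ ∀ u ∈ U₁, ∃ δ : ℝ, 0 < δ ∧ ∀ t : ℝ, t ≠ 0 → |t| < δ → (∀ 𝒟 : Literature.Geometry.Lorentzian.VacuumCauchyDevelopment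 (G (t • u)), 𝒟.IsMaximal → ∀ (O : Set 𝒟.carrier) (d : Literature.Geometry.Lorentzian.FinalStateDecomposition 𝒟.toSpacetime O 0), O = Summit.FinalStateConjecture.exteriorOf 𝒟.toCauchyDevelopment d.charted → Summit.FinalStateConjecture.RaysStayInClosure 𝒟.toCauchyDevelopment O → Summit.FinalStateConjecture.HasExhaustiveCharts d → Summit.FinalStateConjecture.IsFutureOriented d → ∀ i, Literature.Geometry.Lorentzian.Kerr.IsSubextremal (d.mass i) (d.spin i)) := by
  sorry

/-- **Stub B `stub_censoredAlongEnrichment`** — censorship along general-position rays of a tame enrichment of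
a censored curve whose base has an MGHD with incomplete `𝓘⁺`. [cite: Christodoulou1999instability, Thm. 4.1] -/
theorem stub_censoredAlongEnrichment :
    ∀ (X : Type) [TopologicalSpace X] [ChartedSpace Literature.Geometry.Lorentzian.E3 X] [IsManifold (𝓡 3) (⊤ : ℕ∞) X] [T2Space X] [SecondCountableTopology X] [ConnectedSpace X], ∀ (e : Literature.Geometry.Lorentzian.AFEnd X) (G : (EuclideanSpace ℝ (Fin 2) → Literature.Geometry.Lorentzian.InitialDataSet (𝓡 3) X)) (L : (EuclideanSpace ℝ (Fin 1) →ₗ[ℝ] EuclideanSpace ℝ (Fin 2))), Function.Injective L → Literature.Geometry.Lorentzian.InitialDataSet.IsTameDataFamily e 2 G → Literature.Geometry.Lorentzian.InitialDataSet.IsImmersedAtZero 2 G → (∀ q, G q ∈ Literature.Geometry.Lorentzian.admissibleVacuumData X) → (∃ 𝒟 : Literature.Geometry.Lorentzian.VacuumCauchyDevelopment (G 0), 𝒟.IsMaximal ∧ ¬ Summit.FinalStateConjecture.HasCompleteNullInfinity 𝒟.toCauchyDevelopment) → (∀ c ≠ 0, (∀ 𝒟 : Literature.Geometry.Lorentzian.VacuumCauchyDevelopment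 (G (L c)), 𝒟.IsMaximal → Summit.FinalStateConjecture.HasCompleteNullInfinity 𝒟.toCauchyDevelopment)) → ∃ U₂ : Set (EuclideanSpace ℝ (Fin 2)), IsOpen U₂ ∧ Dense U₂ ∧ ∀ u ∈ U₂, ∃ δ : ℝ, 0 < δ ∧ ∀ t : ℝ, t ≠ 0 → |t| < δ → (∀ 𝒟 : Literature.Geometry.Lorentzian.VacuumCauchyDevelopment (G (t • u)), 𝒟.IsMaximal → Summit.FinalStateConjecture.HasCompleteNullInfinity 𝒟.toCauchyDevelopment) := by
  sorry

/-- **Stub C `stub_packGeneralPosition`** — general position + reparametrisation packaging (provable now).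
[cite: Christodoulou1999, p. A24] -/
theorem stub_packGeneralPosition :
    ∀ (X : Type) [TopologicalSpace X] [ChartedSpace Literature.Geometry.Lorentzian.E3 X] [IsManifold (𝓡 3) (⊤ : ℕ∞) X] [T2Space X] [SecondCountableTopology X] [ConnectedSpace X], ∀ (e : Literature.Geometry.Lorentzian.AFEnd X) (G : (EuclideanSpace ℝ (Fin 2) → Literature.Geometry.Lorentzian.InitialDataSet (𝓡 3) X)) (U₁ U₂ : Set (EuclideanSpace ℝ (Fin 2))), Literature.Geometry.Lorentzian.InitialDataSet.IsTameDataFamily e 2 G → Literature.Geometry.Lorentzian.InitialDataSet.IsImmersedAtZero 2 G → (∀ q, G q ∈ Literature.Geometry.Lorentzian.admissibleVacuumData X) → IsOpen U₁ → Dense U₁ → IsOpen U₂ → Dense U₂ → (∀ u ∈ U₁, ∃ δ : ℝ, 0 < δ ∧ ∀ t : ℝ, t ≠ 0 → |t| < δ → (∀ 𝒟 : Literature.Geometry.Lorentzian.VacuumCauchyDevelopment (G (t • u)), 𝒟.IsMaximal → ∀ (O : Set 𝒟.carrier) (d : Literature.Geometry.Lorentzian.FinalStateDecomposition 𝒟.toSpacetime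 O 0), O = Summit.FinalStateConjecture.exteriorOf 𝒟.toCauchyDevelopment d.charted → Summit.FinalStateConjecture.RaysStayInClosure 𝒟.toCauchyDevelopment O → Summit.FinalStateConjecture.HasExhaustiveCharts d → Summit.FinalStateConjecture.IsFutureOriented d → ∀ i, Literature.Geometry.Lorentzian.Kerr.IsSubextremal (d.mass i) (d.spin i))) → (∀ u ∈ U₂, ∃ δ : ℝ, 0 < δ ∧ ∀ t : ℝ, t ≠ 0 → |t| < δ → (∀ 𝒟 : Literature.Geometry.Lorentzian.VacuumCauchyDevelopment (G (t • u)), 𝒟.IsMaximal → Summit.FinalStateConjecture.HasCompleteNullInfinity 𝒟.toCauchyDevelopment)) → ∃ (e' : Literature.Geometry.Lorentzian.AFEnd X) (F' : (EuclideanSpace ℝ (Fin 1) → Literature.Geometry.Lorentzian.InitialDataSet (𝓡 3) X)), Literature.Geometry.Lorentzian.InitialDataSet.IsTameDataFamily e' 1 F' ∧ Literature.Geometry.Lorentzian.InitialDataSet.IsImmersedAtZero 1 F' ∧ F' 0 = G 0 ∧ Function.Injective F' ∧ (∀ c, F' c ∈ Literature.Geometry.Lorentzian.admissibleVacuumData X)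 ∧ ∃ ε > (0 : ℝ), ∀ c, c ≠ 0 → ‖c‖ < ε → ∀ 𝒟 : Literature.Geometry.Lorentzian.VacuumCauchyDevelopment (F' c), 𝒟.IsMaximal → Summit.FinalStateConjecture.HasCompleteNullInfinity 𝒟.toCauchyDevelopment ∧ ∀ (O : Set 𝒟.carrier) (d : Literature.Geometry.Lorentzian.FinalStateDecomposition 𝒟.toSpacetime O 0), O = Summit.FinalStateConjecture.exteriorOf 𝒟.toCauchyDevelopment d.charted → Summit.FinalStateConjecture.RaysStayInClosure 𝒟.toCauchyDevelopment O → Summit.FinalStateConjecture.HasExhaustiveCharts d → Summit.FinalStateConjecture.IsFutureOriented d → ∀ i, Literature.Geometry.Lorentzian.Kerr.IsSubextremal (d.mass i) (d.spin i) := by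
  sorry

/-- **X₃ from the three stubs** (conclusion verbatim the registered piece `CensoredLanding` =
`stub_censoredLanding`). [folklore] -/
theorem CensoredLanding_of
    (hA : ∀ (X : Type) [TopologicalSpace X] [ChartedSpace Literature.Geometry.Lorentzian.E3 X] [IsManifold (𝓡 3) (⊤ : ℕ∞) X] [T2Space X] [SecondCountableTopology X] [ConnectedSpace X], ∀ (e : Literature.Geometry.Lorentzian.AFEnd X) (F : (EuclideanSpace ℝ (Fin 1) → Literature.Geometry.Lorentzian.InitialDataSet (𝓡 3) X)), Literature.Geometry.Lorentzian.InitialDataSet.IsTameDataFamily e 1 F → Literature.Geometry.Lorentzian.InitialDataSet.IsImmersedAtZero 1 F → Function.Injective F → (∀ c, F c ∈ Literature.Geometry.Lorentzian.admissibleVacuumData X) → (∃ 𝒟 : Literature.Geometry.Lorentzian.VacuumCauchyDevelopment (F 0), 𝒟.IsMaximal ∧ ¬ Summit.FinalStateConjecture.HasCompleteNullInfinity 𝒟.toCauchyDevelopment) → (∀ c ≠ 0, (∀ 𝒟 : Literature.Geometry.Lorentzian.VacuumCauchyDevelopment (F c), 𝒟.IsMaximal → Summit.FinalStateConjecture.HasCompleteNullInfinity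 𝒟.toCauchyDevelopment)) → ∃ (G : (EuclideanSpace ℝ (Fin 2) → Literature.Geometry.Lorentzian.InitialDataSet (𝓡 3) X)) (L : (EuclideanSpace ℝ (Fin 1) →ₗ[ℝ] EuclideanSpace ℝ (Fin 2))), Function.Injective L ∧ (∀ c, G (L c) = F c) ∧ Literature.Geometry.Lorentzian.InitialDataSet.IsTameDataFamily e 2 G ∧ Literature.Geometry.Lorentzian.InitialDataSet.IsImmersedAtZero 2 G ∧ (∀ q, G q ∈ Literature.Geometry.Lorentzian.admissibleVacuumData X) ∧ ∃ U₁ : Set (EuclideanSpace ℝ (Fin 2)), IsOpen U₁ ∧ Dense U₁ ∧ ∀ u ∈ U₁, ∃ δ : ℝ, 0 < δ ∧ ∀ t : ℝ, t ≠ 0 → |t| < δ → (∀ 𝒟 : Literature.Geometry.Lorentzian.VacuumCauchyDevelopment (G (t • u)), 𝒟.IsMaximal → ∀ (O : Set 𝒟.carrier) (d : Literature.Geometry.Lorentzian.FinalStateDecomposition 𝒟.toSpacetime O 0), O = Summit.FinalStateConjecture.exteriorOf 𝒟.toCauchyDevelopment d.charted → Summit.FinalStateConjecture.RaysStayInClosure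 𝒟.toCauchyDevelopment O → Summit.FinalStateConjecture.HasExhaustiveCharts d → Summit.FinalStateConjecture.IsFutureOriented d → ∀ i, Literature.Geometry.Lorentzian.Kerr.IsSubextremal (d.mass i) (d.spin i)))
    (hB : ∀ (X : Type) [TopologicalSpace X] [ChartedSpace Literature.Geometry.Lorentzian.E3 X] [IsManifold (𝓡 3) (⊤ : ℕ∞) X] [T2Space X] [SecondCountableTopology X] [ConnectedSpace X], ∀ (e : Literature.Geometry.Lorentzian.AFEnd X) (G : (EuclideanSpace ℝ (Fin 2) → Literature.Geometry.Lorentzian.InitialDataSet (𝓡 3) X)) (L : (EuclideanSpace ℝ (Fin 1) →ₗ[ℝ] EuclideanSpace ℝ (Fin 2))), Function.Injective L → Literature.Geometry.Lorentzian.InitialDataSet.IsTameDataFamily e 2 G → Literature.Geometry.Lorentzian.InitialDataSet.IsImmersedAtZero 2 G → (∀ q, G q ∈ Literature.Geometry.Lorentzian.admissibleVacuumData X) → (∃ 𝒟 : Literature.Geometry.Lorentzian.VacuumCauchyDevelopment (G 0), 𝒟.IsMaximal ∧ ¬ Summit.FinalStateConjecture.HasCompleteNullInfinity 𝒟.toCauchyDevelopment)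 → (∀ c ≠ 0, (∀ 𝒟 : Literature.Geometry.Lorentzian.VacuumCauchyDevelopment (G (L c)), 𝒟.IsMaximal → Summit.FinalStateConjecture.HasCompleteNullInfinity 𝒟.toCauchyDevelopment)) → ∃ U₂ : Set (EuclideanSpace ℝ (Fin 2)), IsOpen U₂ ∧ Dense U₂ ∧ ∀ u ∈ U₂, ∃ δ : ℝ, 0 < δ ∧ ∀ t : ℝ, t ≠ 0 → |t| < δ → (∀ 𝒟 : Literature.Geometry.Lorentzian.VacuumCauchyDevelopment (G (t • u)), 𝒟.IsMaximal → Summit.FinalStateConjecture.HasCompleteNullInfinity 𝒟.toCauchyDevelopment))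
    (hC : ∀ (X : Type) [TopologicalSpace X] [ChartedSpace Literature.Geometry.Lorentzian.E3 X] [IsManifold (𝓡 3) (⊤ : ℕ∞) X] [T2Space X] [SecondCountableTopology X] [ConnectedSpace X], ∀ (e : Literature.Geometry.Lorentzian.AFEnd X) (G : (EuclideanSpace ℝ (Fin 2) → Literature.Geometry.Lorentzian.InitialDataSet (𝓡 3) X)) (U₁ U₂ : Set (EuclideanSpace ℝ (Fin 2))), Literature.Geometry.Lorentzian.InitialDataSet.IsTameDataFamily e 2 G → Literature.Geometry.Lorentzian.InitialDataSet.IsImmersedAtZero 2 G → (∀ q, G q ∈ Literature.Geometry.Lorentzian.admissibleVacuumData X) → IsOpen U₁ → Dense U₁ → IsOpen U₂ → Dense U₂ → (∀ u ∈ U₁, ∃ δ : ℝ, 0 < δ ∧ ∀ t : ℝ, t ≠ 0 → |t| < δ → (∀ 𝒟 : Literature.Geometry.Lorentzian.VacuumCauchyDevelopment (G (t • u)), 𝒟.IsMaximal → ∀ (O : Set 𝒟.carrier) (d : Literature.Geometry.Lorentzian.FinalStateDecomposition 𝒟.toSpacetime O 0), O = Summit.FinalStateConjecture.exteriorOf 𝒟.toCauchyDevelopment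 d.charted → Summit.FinalStateConjecture.RaysStayInClosure 𝒟.toCauchyDevelopment O → Summit.FinalStateConjecture.HasExhaustiveCharts d → Summit.FinalStateConjecture.IsFutureOriented d → ∀ i, Literature.Geometry.Lorentzian.Kerr.IsSubextremal (d.mass i) (d.spin i))) → (∀ u ∈ U₂, ∃ δ : ℝ, 0 < δ ∧ ∀ t : ℝ, t ≠ 0 → |t| < δ → (∀ 𝒟 : Literature.Geometry.Lorentzian.VacuumCauchyDevelopment (G (t • u)), 𝒟.IsMaximal → Summit.FinalStateConjecture.HasCompleteNullInfinity 𝒟.toCauchyDevelopment)) → ∃ (e' : Literature.Geometry.Lorentzian.AFEnd X) (F' : (EuclideanSpace ℝ (Fin 1) → Literature.Geometry.Lorentzian.InitialDataSet (𝓡 3) X)), Literature.Geometry.Lorentzian.InitialDataSet.IsTameDataFamily e' 1 F' ∧ Literature.Geometry.Lorentzian.InitialDataSet.IsImmersedAtZero 1 F' ∧ F' 0 = G 0 ∧ Function.Injective F' ∧ (∀ c, F' c ∈ Literature.Geometry.Lorentzian.admissibleVacuumData X) ∧ ∃ ε > (0 : ℝ), ∀ c, c ≠ 0 → ‖c‖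 < ε → ∀ 𝒟 : Literature.Geometry.Lorentzian.VacuumCauchyDevelopment (F' c), 𝒟.IsMaximal → Summit.FinalStateConjecture.HasCompleteNullInfinity 𝒟.toCauchyDevelopment ∧ ∀ (O : Set 𝒟.carrier) (d : Literature.Geometry.Lorentzian.FinalStateDecomposition 𝒟.toSpacetime O 0), O = Summit.FinalStateConjecture.exteriorOf 𝒟.toCauchyDevelopment d.charted → Summit.FinalStateConjecture.RaysStayInClosure 𝒟.toCauchyDevelopment O → Summit.FinalStateConjecture.HasExhaustiveCharts d → Summit.FinalStateConjecture.IsFutureOriented d → ∀ i, Literature.Geometry.Lorentzian.Kerr.IsSubextremal (d.mass i) (d.spin i)) :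
    ∀ (X : Type) [TopologicalSpace X] [ChartedSpace Literature.Geometry.Lorentzian.E3 X] [IsManifold (𝓡 3) (⊤ : ℕ∞) X] [T2Space X] [SecondCountableTopology X] [ConnectedSpace X], ∀ (e : Literature.Geometry.Lorentzian.AFEnd X) (F : EuclideanSpace ℝ (Fin 1) → Literature.Geometry.Lorentzian.InitialDataSet (𝓡 3) X), Literature.Geometry.Lorentzian.InitialDataSet.IsTameDataFamily e 1 F → Literature.Geometry.Lorentzian.InitialDataSet.IsImmersedAtZero 1 F → Function.Injective F → (∀ c, F c ∈ Literature.Geometry.Lorentzian.admissibleVacuumData X) → (∃ 𝒟 : Literature.Geometry.Lorentzian.VacuumCauchyDevelopment (F 0), 𝒟.IsMaximal ∧ ¬ Summit.FinalStateConjecture.HasCompleteNullInfinity 𝒟.toCauchyDevelopment) → (∀ c ≠ 0, ∀ 𝒟 : Literature.Geometry.Lorentzian.VacuumCauchyDevelopment (F c), 𝒟.IsMaximal → Summit.FinalStateConjecture.HasCompleteNullInfinity 𝒟.toCauchyDevelopment) → ∃ (e' : Literature.Geometry.Lorentzian.AFEnd X) (F' : EuclideanSpace ℝ (Fin 1) →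 Literature.Geometry.Lorentzian.InitialDataSet (𝓡 3) X), Literature.Geometry.Lorentzian.InitialDataSet.IsTameDataFamily e' 1 F' ∧ Literature.Geometry.Lorentzian.InitialDataSet.IsImmersedAtZero 1 F' ∧ F' 0 = F 0 ∧ Function.Injective F' ∧ (∀ c, F' c ∈ Literature.Geometry.Lorentzian.admissibleVacuumData X) ∧ ∃ ε > (0 : ℝ), ∀ c, c ≠ 0 → ‖c‖ < ε → ∀ 𝒟 : Literature.Geometry.Lorentzian.VacuumCauchyDevelopment (F' c), 𝒟.IsMaximal → Summit.FinalStateConjecture.HasCompleteNullInfinity 𝒟.toCauchyDevelopment ∧ ∀ (O : Set 𝒟.carrier) (d : Literature.Geometry.Lorentzian.FinalStateDecomposition 𝒟.toSpacetime O 0), O = Summit.FinalStateConjecture.exteriorOf 𝒟.toCauchyDevelopment d.charted → Summit.FinalStateConjecture.RaysStayInClosure 𝒟.toCauchyDevelopment O → Summit.FinalStateConjecture.HasExhaustiveCharts d → Summit.FinalStateConjecture.IsFutureOriented d → ∀ i, Literature.Geometry.Lorentzian.Kerr.IsSubextremal (d.mass i) (d.spin i) := by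
  intro X _ _ _ _ _ _ e F hF himm hinj h𝓓 hV hcens
  obtain ⟨G, L, hL, hGL, hG, hGimm, hG𝓓, U₁, hU₁o, hU₁d, hthird⟩ :=
    hA X e F hF himm hinj h𝓓 hV hcens
  have hG0 : G 0 = F 0 := by simpa using hGL 0
  have hV' : ∃ 𝒟 : Literature.Geometry.Lorentzian.VacuumCauchyDevelopment (G 0), 𝒟.IsMaximal ∧
      ¬ Summit.FinalStateConjecture.HasCompleteNullInfinity 𝒟.toCauchyDevelopment := by
    rw [hG0]; exact hV
  have hcens' : ∀ c ≠ 0,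
      ∀ 𝒟 : Literature.Geometry.Lorentzian.VacuumCauchyDevelopment (G (L c)), 𝒟.IsMaximal →
        Summit.FinalStateConjecture.HasCompleteNullInfinity 𝒟.toCauchyDevelopment := by
    intro c hc
    rw [hGL c]
    exact hcens c hc
  obtain ⟨U₂, hU₂o, hU₂d, hcensU⟩ := hB X e G L hL hG hGimm hG𝓓 hV' hcens'
  obtain ⟨e', F', hF', himm', h0', hinj', h𝓓', ε, hε, hgood⟩ :=
    hC X e G U₁ U₂ hG hGimm hG𝓓 hU₁o hU₁d hU₂o hU₂d hthird hcensU
  exact ⟨e', F', hF', himm', h0'.trans hG0, hinj', h𝓓', ε, hε, hgood⟩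

end Summit.FinalStateConjecture.FinalStateConjecture.Cruxes.GenericCensorshipThirdLaw.CensoredCurvesSplit.BirthX3

end
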